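import Mathlib
import HarnessLib
import Summits.HubbardSuperconductivity.HubbardSuperconductivity.Theorems.KLProgrammeKLRegimeEngineTowerChernoff

/-!
# Route `KLProgramme` — crux K3 ENGINE (stmt-HubbardSuperconductivity-20437 `KLRegimeEngineV17F2`), stub (b): the blocked-tower bookkeeping — THE TWO-LEG TADPOLE-FREE STEP
# IN CLOSED FORM on the four-piece profile (located «(E2)-ROUTE-TADPOLE», recipe «(E2)-POW3-TRACK» item T6; pen g27 (R472)(D), (R479); cell gate-hubbard-kl, seat hubbard-kl-k3c3-p2 g20)

The kit's closed-form block step (`towerStep_le_profile₃`, `towerStep_le_of_chernoff`, …TowerBookkeepingSharp / …TowerChernoff) is stated for the law's degrees `p ≥ 3`; its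
first-order functional `towerFO D σ μ p` at `p = 1` (two legs) would read the quartic input at first order — the block TADPOLE `6σ·μ 2`, first order in the four-leg import.
The tadpole-free increment `Δ_k − Δ_Γ 𝒱_{dk}` (…TowerBlockIncrWtPowAtKitSubTad) has instead the first order `towerFO D σ μ♭ 1` on the TRUNCATED array
`μ♭ m := if 2 < m then μ m else 0`.  This file is the corresponding real-analysis closed form on the FOUR-PIECE profile `μ 1 ≤ ι₁λ`, `μ 2 ≤ ι₂λ`, `μ 3 ≤ ι₃λ²`,
`μ m ≤ A′λ^{m−1}Q′^m` (`4 ≤ m ≤ D`):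

* `towerFO_trunc_one_le_of_fourPiece` — `towerFO D σ μ♭ 1 ≤ 15σ²(ι₃λ²) + A′(4Q′)·x₁³/(1−x₁)`, `x₁ = 4σλQ′` (six legs with two self-contracted pairs; eight legs on geometric,
  `C(2m,2) ≤ 4^m`);
* **`towerStepTwoSub_le_closed`** — from the suppliers' two-leg step (∀ `N ≥ 2`, under the guard `ΦV < 1`) with first order `towerFO D σ μ♭ 1` and graded orders / tail on `μ`:
  `b ≤ 15σ²(ι₃λ²) + A′(4Q′)·x₁³/(1−x₁) + e·ψ·G·(ΦG/(1−ΦG))`, `G = τ(ι₁λ + ι₂/(2Q′) + ι₃/(4Q′²) + A′Q′/4)` — by `towerStep_le_of_chernoff` (generic in `p` and in the first-order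
  bound) applied to the born size SHIFTED by `towerFO(μ) − towerFO(μ♭)`; NO `σ·ι₂` term: every summand is of second order in the imports.
Pure real analysis; nothing about the model is asserted; nothing asserts (E2), any stub, K3 or superconductivity.
References: BGM 2006 §2.8 (2.83), (2.93)–(2.98), §3 (3.2)–(3.8) [cite: BenfattoGiulianiMastropietro2006]; Gawȩdzki–Kupiainen 1985 §3.
-/

noncomputable section

namespace Summit.HubbardSuperconductivity.HubbardSuperconductivity.Theorems.EngineV8

set_option linter.dupNamespace false -- summit = problem name (single-conjunct summit), D-0017

open Real Finset
/-! ## §1 Pure real analysis: the two-leg tadpole-free first order and the two-leg step in closed form (four-piece profile) -/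

/-- **The tadpole-free two-leg first order of a four-piece profile.**  With the truncated array `μ♭ m := if 2 < m then μ m else 0` (no quartic input at first order),
`μ 3 ≤ ι₃λ²`, `μ m ≤ A′λ^{m−1}Q′^m` (`4 ≤ m ≤ D`) and `x₁ = 4σλQ′ < 1`:
`towerFO D σ μ♭ 1 ≤ 15·σ²·(ι₃λ²) + A′·(4Q′)·(x₁³/(1−x₁))` — the six-leg input with two self-contracted pairs, and the geometric tail from eight legs on
(`C(2m,2) ≤ 4^m`). [cite: BenfattoGiulianiMastropietro2006, §2.8 (2.83), (2.93)-(2.98)] -/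
theorem towerFO_trunc_one_le_of_fourPiece {D : ℕ} {σ A' lam Q' ι₃ : ℝ} {μ : ℕ → ℝ} (hσ : 0 ≤ σ) (hA' : 0 ≤ A') (hlam : 0 ≤ lam) (hQ' : 0 ≤ Q')
    (hμ0 : ∀ m, 0 ≤ μ m) (hι₃ : μ 3 ≤ ι₃ * lam ^ 2) (hprof : ∀ m, 4 ≤ m → m ≤ D → μ m ≤ A' * lam ^ (m - 1) * Q' ^ m)
    (hx₁ : 4 * σ * lam * Q' < 1) :
    towerFO D σ (fun m => if 2 < m then μ m else 0) 1 ≤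
      15 * σ ^ 2 * (ι₃ * lam ^ 2) + A' * (4 * Q') * ((4 * σ * lam * Q') ^ 3 / (1 - 4 * σ * lam * Q')) := by
  have hx0 : 0 ≤ 4 * σ * lam * Q' := by positivity
  have hι₃0 : 0 ≤ ι₃ * lam ^ 2 := (hμ0 3).trans hι₃
  set f : ℕ → ℝ := fun m => (if m = 3 then 15 * σ ^ 2 * (ι₃ * lam ^ 2) else 0) +
    A' * (4 * Q') * (if 3 + 1 ≤ m then (4 * σ * lam * Q') ^ (m - 1) else 0) with hf
  have hterm : ∀ m ∈ Ioc 1 D, ((2 * m).choose (2 * 1) : ℝ) * σ ^ (m - 1) * (fun m => if 2 < m then μ m else 0) m ≤ f m := by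
    intro m hm
    rw [mem_Ioc] at hm
    dsimp only
    rw [hf]; dsimp only
    by_cases h2 : 2 < m
    · rw [if_pos h2]
      by_cases h3 : m = 3
      · subst h3
        rw [if_pos rfl, if_neg (by omega), mul_zero, add_zero]
        have hch : ((2 * 3).choose (2 * 1) : ℝ) = 15 := by norm_num [Nat.choose]
        rw [hch, show (3 : ℕ) - 1 = 2 from rfl]
        exact mul_le_mul_of_nonneg_left hι₃ (by positivity)
      · have h4 : 4 ≤ m := by omega
        rw [if_neg h3, if_pos (by omega), zero_add]
        have hch : ((2 * m).choose (2 * 1) : ℝ) ≤ (4 : ℝ) ^ m := by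
          have h := Nat.choose_le_two_pow (2 * m) (2 * 1)
          rw [pow_mul] at h
          exact_mod_cast h
        have hμm := hprof m h4 hm.2
        have hμ0m := hμ0 m
        calc ((2 * m).choose (2 * 1) : ℝ) * σ ^ (m - 1) * μ m
            ≤ (4 : ℝ) ^ m * σ ^ (m - 1) * (A' * lam ^ (m - 1) * Q' ^ m) := by gcongr
          _ = A' * (4 * Q') * (4 * σ * lam * Q') ^ (m - 1) := by
              obtain ⟨j, rfl⟩ : ∃ j, m = j + 1 := ⟨m - 1, by omega⟩
              simp only [Nat.add_sub_cancel, pow_succ, mul_pow]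
              ring
    · rw [if_neg h2, mul_zero]
      positivity
  unfold towerFO
  refine (sum_le_sum hterm).trans ?_
  rw [hf, sum_add_distrib, ← mul_sum]
  refine add_le_add ?_ (mul_le_mul_of_nonneg_left ?_ (by positivity))
  · rw [sum_ite_eq']
    split_ifs
    · exact le_rfl
    · positivity
  · calc ∑ m ∈ Ioc 1 D, (if 3 + 1 ≤ m then (4 * σ * lam * Q') ^ (m - 1) else 0)
        ≤ ∑ m ∈ Icc 1 D, (if 3 + 1 ≤ m then (4 * σ * lam * Q') ^ (m - 1) else 0) := by
          refine sum_le_sum_of_subset_of_nonneg (fun m hm => ?_) fun m _ _ => ?_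
          · rw [mem_Ioc] at hm; rw [mem_Icc]; omega
          · split_ifs; exacts [pow_nonneg hx0 _, le_rfl]
      _ ≤ (4 * σ * lam * Q') ^ 3 / (1 - 4 * σ * lam * Q') := sum_Icc_ite_pow_le_of_le hx0 hx₁ 3 D

/-- **The two-leg TADPOLE-FREE step in closed form, four-piece profile.**  Inputs `μ ≥ 0` with `μ 1 ≤ ι₁λ`, `μ 2 ≤ ι₂λ`, `μ 3 ≤ ι₃λ²`, `μ m ≤ A′λ^{m−1}Q′^m`
(`4 ≤ m ≤ D`); smallness `x₁ = 4σλQ′ < 1`, `2λτQ′ ≤ 1`, `x₃ = eτλQ′ < 1`, `y = Φ·G < 1` with `G = τ(ι₁λ + ι₂/(2Q′) + ι₃/(4Q′²) + A′Q′/4)`, `θ̄ = Φ·V̄ < 1` (four-piece `V̄`);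
the suppliers' two-leg step ∀ N ≥ 2 under the guard `ΦV < 1` with the TADPOLE-FREE first order `towerFO D σ μ♭ 1` (`μ♭ m := if 2 < m then μ m else 0`) and the
graded orders / tail on `μ`: then `b ≤ 15σ²(ι₃λ²) + A′(4Q′)·x₁³/(1−x₁) + e·ψ·G·(y/(1−y))` — every summand of second order in the imports (six-leg import; eight legs on;
`(two- and four-leg imports)²` through `G·y`), no `σ·ι₂` (tadpole) term. [cite: BenfattoGiulianiMastropietro2006, §2.8 (2.83), (2.93)-(2.98), §3 (3.2)-(3.8)] -/
theorem towerStepTwoSub_le_closed {D : ℕ} {μ : ℕ → ℝ} {b σ Φ ψ τ A' lam Q' ι₁ ι₂ ι₃ : ℝ}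
    (hσ : 0 ≤ σ) (hΦ : 0 ≤ Φ) (hψ : 0 ≤ ψ) (hτ : 0 < τ) (hA' : 0 ≤ A') (hlam : 0 < lam) (hQ' : 0 < Q')
    (hμ0 : ∀ m, 0 ≤ μ m) (hι₁ : μ 1 ≤ ι₁ * lam) (hι₂ : μ 2 ≤ ι₂ * lam) (hι₃ : μ 3 ≤ ι₃ * lam ^ 2)
    (hprof : ∀ m, 4 ≤ m → m ≤ D → μ m ≤ A' * lam ^ (m - 1) * Q' ^ m)
    (hx₁ : 4 * σ * lam * Q' < 1) (hx₂ : 2 * lam * τ * Q' ≤ 1) (hx₃ : exp 1 * τ * lam * Q' < 1)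
    (hy : Φ * (τ * (ι₁ * lam + ι₂ / (2 * Q') + ι₃ / (4 * Q' ^ 2) + A' * Q' / 4)) < 1)
    (hθ : Φ * (exp 1 * τ * (ι₁ * lam) + (exp 1 * τ) ^ 2 * (ι₂ * lam) + (exp 1 * τ) ^ 3 * (ι₃ * lam ^ 2) +
      A' * (exp 1 * τ * Q') * ((exp 1 * τ * lam * Q') ^ 3 / (1 - exp 1 * τ * lam * Q'))) < 1)
    (hstep : ∀ N : ℕ, 2 ≤ N → Φ * towerV D τ μ < 1 →
      b ≤ towerFO D σ (fun m => if 2 < m then μ m else 0) 1 + ∑ n ∈ Icc 2 N, exp 1 * Φ ^ (n - 1) * ψ ^ 1 * towerS D τ μ n 1 +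
        ψ ^ 1 * exp 1 * towerV D τ μ * (Φ * towerV D τ μ) ^ N / (1 - Φ * towerV D τ μ)) :
    b ≤ 15 * σ ^ 2 * (ι₃ * lam ^ 2) + A' * (4 * Q') * ((4 * σ * lam * Q') ^ 3 / (1 - 4 * σ * lam * Q')) +
      exp 1 * ψ * (τ * (ι₁ * lam + ι₂ / (2 * Q') + ι₃ / (4 * Q' ^ 2) + A' * Q' / 4)) *
        (Φ * (τ * (ι₁ * lam + ι₂ / (2 * Q') + ι₃ / (4 * Q' ^ 2) + A' * Q' / 4)) /
          (1 - Φ * (τ * (ι₁ * lam + ι₂ / (2 * Q') + ι₃ / (4 * Q' ^ 2) + A' * Q' / 4)))) := by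
  set G := τ * (ι₁ * lam + ι₂ / (2 * Q') + ι₃ / (4 * Q' ^ 2) + A' * Q' / 4) with hG
  -- shift the born size by the first-order difference, so that the step reads the full `towerFO`
  set b' := b + (towerFO D σ μ 1 - towerFO D σ (fun m => if 2 < m then μ m else 0) 1) with hb'
  have hw : 1 ≤ (2 * τ * Q' * lam)⁻¹ := (one_le_inv₀ (by positivity)).2 (by linarith)
  have hstep' : ∀ N : ℕ, 2 ≤ N → Φ * towerV D τ μ < 1 →
      b' ≤ towerFO D σ μ 1 + ∑ n ∈ Icc 2 N, exp 1 * Φ ^ (n - 1) * ψ ^ 1 * towerS D τ μ n 1 +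
        ψ ^ 1 * exp 1 * towerV D τ μ * (Φ * towerV D τ μ) ^ N / (1 - Φ * towerV D τ μ) := by
    intro N hN hg
    have := hstep N hN hg
    rw [hb']; linarith
  have hGsum := sum_fourPiece_le (D := D) hτ hlam hQ' hA' hμ0 hι₁ hι₂ hι₃ hprof
  have hVb := towerV_le_fourPiece (D := D) hτ.le hlam.le hQ'.le hA' hμ0 hι₁ hι₂ hι₃ hprof hx₃
  have h := towerStep_le_of_chernoff (D := D) (p := 1) hΦ hψ hτ.le hμ0 hw le_rfl hGsum hVb hy hθ hstep'
  have hFO := towerFO_trunc_one_le_of_fourPiece (D := D) hσ hA' hlam.le hQ'.le hμ0 hι₃ hprof hx₁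
  rw [hb', ← hG] at h
  simp only [pow_one, Nat.sub_self, pow_zero, inv_one, mul_one] at h
  linarith

end Summit.HubbardSuperconductivity.HubbardSuperconductivity.Theorems.EngineV8

end
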